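import Summits.CriticalPhenomena.Ising3DConformalLimit.Theorems.PerfectScreeningGaussianLimitNotScreenedAmplitudeFloorDCP
import HarnessLib

/-!
# Crux `GaussianLimitNotScreened` (stmt-CriticalPhenomena-13886), line `free-regular-variation-dcp-window`
# (split D1): the renormalisation of a Möbius limit is at most canonical-at-the-corner, `ρ(1/m)² = O(m^{3/2})`

THEOREM-ONLY helper file (lead c5, registered bookkeeping stub `stub_renormBoundDCP`). For every
non-degenerate Möbius-covariant pointwise scaling limit `(ρ, Δ, S)` of the critical Ising₃ correlators
`criticalCorr 3` (any `Δ`, no Gaussianity), the single-spin renormalisation obeys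

  `ρ(1/m)² ≤ C · m^{3/2}` for all large `m`.

This is the landed amplitude-sharp Duminil-Copin–Panis floor `stub_amplitudeFloorDCP`
(`n³ ⟨σ₀σ_{ne₀}⟩²_{β_c} ≥ c`, Theorems/PerfectScreeningGaussianLimitNotScreenedAmplitudeFloorDCP.lean) read
through the limit at the reference pair, `ρ(1/m)² ⟨σ₀σ_{me₀}⟩_{β_c} → S₂(0,e₀)`
(`HasPointwiseScalingLimit.tendsto_renorm_sq_mul_axis`). It is the corner companion of the two
renormalisation statements the crux is built from: leaf (α) says that at `Δ = 1/2` the renormalisation is NOT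
super-canonical (`¬ ρ(1/m)²/m → ∞`, open), while here, at the other end of the window, `ρ(1/m)²/m^{3/2}` is
BOUNDED for every Möbius limit whatsoever — at `Δ = 3/4` the renormalisation is canonical up to constants
(a theorem), so leaf (γ) concerns only limits with `ρ(1/m)² ≍ m^{3/2}·O(1)`.

References: H. Duminil-Copin, R. Panis, Comm. Math. Phys. 406 (2025), arXiv:2404.05700, Theorems 1.3, 1.5.
-/

noncomputable section

open Filter Topology Set
open Literature.Probability.LatticeModels
open Summit.CriticalPhenomena.Ising3DConformalLimit.GaussianLimitNotScreenedNegative (refPair_pos)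

namespace Summit.CriticalPhenomena.Ising3DConformalLimit.Cruxes.GaussianLimitNotScreened.FreeRegularVariationDcpWindow

/-- `√(x³) = x^{3/2}` for `x ≥ 0`. [folklore] -/
private theorem sqrt_pow_three {x : ℝ} (hx : 0 ≤ x) : Real.sqrt (x ^ 3) = x ^ (3 / 2 : ℝ) := by
  rw [Real.sqrt_eq_rpow, ← Real.rpow_natCast, ← Real.rpow_mul hx]
  norm_num

/-- **Registered bookkeeping stub `stub_renormBoundDCP` — the renormalisation of a Möbius limit is
`O(m^{3/2})`.** For every non-degenerate Möbius-covariant pointwise scaling limit `(ρ, Δ, S)` of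
`criticalCorr 3` there is `C > 0` with `ρ(1/m)² ≤ C·m^{3/2}` for all large `m`: from the amplitude-sharp
DCP floor `n³⟨σ₀σ_{ne₀}⟩² ≥ c` (`stub_amplitudeFloorDCP`) and `ρ(1/m)²⟨σ₀σ_{me₀}⟩ → S₂(0,e₀)`.
At the corner `Δ = 3/4` this is "canonical up to constants"; compare leaf (α) at `Δ = 1/2`.
[cite: DuminilCopinPanis2025LowerBounds, Theorem 1.3] -/
theorem stub_renormBoundDCP :
    ∀ (ρ : ℝ → ℝ) (Δ : ℝ) (S : CorrFamily 3), (∀ δ ∈ Set.Ioc (0:ℝ) 1, 0 < ρ δ) →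
      HasPointwiseScalingLimit (criticalCorr 3) ρ S → IsNondegenerateTwoPoint S →
      IsMoebiusCovariant Δ S →
      ∃ C : ℝ, 0 < C ∧ ∀ᶠ m : ℕ in atTop, ρ (1 / m) ^ 2 ≤ C * (m : ℝ) ^ (3 / 2 : ℝ) := by
  intro ρ Δ S hρ hlim hnd hM
  obtain ⟨c, hc, hfloor⟩ := stub_amplitudeFloorDCP ρ Δ S hρ hlim hnd hM
  have hA : 0 < S 2 ![0, EuclideanSpace.single (0 : Fin 3) (1:ℝ)] := refPair_pos hnd
  set A : ℝ := S 2 ![0, EuclideanSpace.single (0 : Fin 3) (1:ℝ)] with hAdef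
  have hT := hlim.tendsto_renorm_sq_mul_axis
  have hev : ∀ᶠ m : ℕ in atTop,
      ρ (1 / m) ^ 2 * criticalTwoPoint 3 (Pi.single 0 (m : ℤ)) ≤ 2 * A :=
    hT.eventually (eventually_le_nhds (by linarith))
  have hsc : 0 < Real.sqrt c := Real.sqrt_pos.2 hc
  refine ⟨2 * A / Real.sqrt c, by positivity, ?_⟩
  filter_upwards [hev, hfloor] with m h1 h2
  set G : ℝ := criticalTwoPoint 3 (Pi.single 0 (m : ℤ)) with hG
  have hGpos : 0 < G := criticalTwoPoint_axis_pos m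
  have hm0 : (0 : ℝ) ≤ (m : ℝ) := Nat.cast_nonneg m
  -- `√c ≤ m^{3/2} G`
  have h3 : Real.sqrt c ≤ (m : ℝ) ^ (3 / 2 : ℝ) * G := by
    have h := Real.sqrt_le_sqrt h2
    rwa [Real.sqrt_mul (pow_nonneg hm0 3), Real.sqrt_sq hGpos.le, sqrt_pow_three hm0] at h
  -- `ρ² √c ≤ ρ² m^{3/2} G = m^{3/2} (ρ² G) ≤ m^{3/2} · 2A`
  have hρ2 : 0 ≤ ρ (1 / m) ^ 2 := sq_nonneg _
  have hm32 : 0 ≤ (m : ℝ) ^ (3 / 2 : ℝ) := Real.rpow_nonneg hm0 _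
  have h4 : ρ (1 / m) ^ 2 * Real.sqrt c ≤ (m : ℝ) ^ (3 / 2 : ℝ) * (2 * A) :=
    calc ρ (1 / m) ^ 2 * Real.sqrt c ≤ ρ (1 / m) ^ 2 * ((m : ℝ) ^ (3 / 2 : ℝ) * G) :=
          mul_le_mul_of_nonneg_left h3 hρ2
      _ = (m : ℝ) ^ (3 / 2 : ℝ) * (ρ (1 / m) ^ 2 * G) := by ring
      _ ≤ (m : ℝ) ^ (3 / 2 : ℝ) * (2 * A) := mul_le_mul_of_nonneg_left h1 hm32
  rw [← le_div_iff₀ hsc] at h4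
  calc ρ (1 / m) ^ 2 ≤ (m : ℝ) ^ (3 / 2 : ℝ) * (2 * A) / Real.sqrt c := h4
    _ = 2 * A / Real.sqrt c * (m : ℝ) ^ (3 / 2 : ℝ) := by ring

/-- **At the corner the renormalisation is canonical up to constants.** Under the hypotheses of leaf (γ)
(`IsMoebiusCovariant (3/4) S`), `ρ(1/m)²/m^{3/2}` is bounded — the `Δ = 3/4` counterpart of the OPEN leaf (α)
(`Δ = 1/2`: `¬ ρ(1/m)²/m → ∞`) is a theorem. [cite: DuminilCopinPanis2025LowerBounds, Theorem 1.3] -/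
theorem cornerRenorm_isBoundedUnder {ρ : ℝ → ℝ} {S : CorrFamily 3} (hρ : ∀ δ ∈ Set.Ioc (0:ℝ) 1, 0 < ρ δ)
    (hlim : HasPointwiseScalingLimit (criticalCorr 3) ρ S) (hnd : IsNondegenerateTwoPoint S)
    (hM : IsMoebiusCovariant (3 / 4) S) :
    IsBoundedUnder (· ≤ ·) atTop (fun m : ℕ => ρ (1 / m) ^ 2 / (m : ℝ) ^ (3 / 2 : ℝ)) := by
  obtain ⟨C, _, hC⟩ := stub_renormBoundDCP ρ (3 / 4) S hρ hlim hnd hM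
  refine ⟨C, ?_⟩
  rw [eventually_map]
  filter_upwards [hC, eventually_ge_atTop 1] with m hm h1
  have hmpos : (0 : ℝ) < (m : ℝ) ^ (3 / 2 : ℝ) :=
    Real.rpow_pos_of_pos (by exact_mod_cast Nat.lt_of_lt_of_le Nat.zero_lt_one h1) _
  rw [div_le_iff₀ hmpos]
  exact hm

/-- **The corner counterpart of leaf (α) holds outright**: at `Δ = 3/4`, `¬ ρ(1/m)²/m^{3/2} → ∞` for every
non-degenerate Möbius limit of `criticalCorr 3` (no Gaussianity needed). [cite: DuminilCopinPanis2025LowerBounds, Theorem 1.3] -/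
theorem cornerRenorm_not_tendsto_atTop {ρ : ℝ → ℝ} {S : CorrFamily 3} (hρ : ∀ δ ∈ Set.Ioc (0:ℝ) 1, 0 < ρ δ)
    (hlim : HasPointwiseScalingLimit (criticalCorr 3) ρ S) (hnd : IsNondegenerateTwoPoint S)
    (hM : IsMoebiusCovariant (3 / 4) S) :
    ¬ Tendsto (fun m : ℕ => ρ (1 / m) ^ 2 / (m : ℝ) ^ (3 / 2 : ℝ)) atTop atTop := by
  intro hT
  obtain ⟨C, _, hC⟩ := stub_renormBoundDCP ρ (3 / 4) S hρ hlim hnd hM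
  have hge := hT.eventually_ge_atTop (C + 1)
  obtain ⟨m, h1, h2, h3⟩ := (hge.and (hC.and (eventually_ge_atTop 1))).exists
  have hmpos : (0 : ℝ) < (m : ℝ) ^ (3 / 2 : ℝ) :=
    Real.rpow_pos_of_pos (by exact_mod_cast Nat.lt_of_lt_of_le Nat.zero_lt_one h3) _
  rw [le_div_iff₀ hmpos] at h1
  have h1m : (1 : ℝ) ≤ (m : ℝ) ^ (3 / 2 : ℝ) :=
    Real.one_le_rpow (by exact_mod_cast h3) (by norm_num)
  nlinarith

end Summit.CriticalPhenomena.Ising3DConformalLimit.Cruxes.GaussianLimitNotScreened.FreeRegularVariationDcpWindow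

end
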